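import Literature.Computability.AlgebraicComplexity.NilCoxeterTensor
import Literature.Computability.AlgebraicComplexity.SchoenhageTauProofs
import HarnessLib

/-!
# Rank-level degeneration transfer for the nil-Coxeter tensor: `R(T_{NC_n}) ≤ C(n(n−1)/2+2, 2) · R(T_{K[S_n]})`

Topic `Literature/Computability/AlgebraicComplexity` (companion of `NilCoxeterTensor.lean`). The Rees twist
of an optimal exact decomposition of the group tensor `T_{K[S_n]}` is an approximate decomposition of
`T_{NC_n}` of ORDER `h = n(n−1)/2` (`approxRank_nilCoxeterTensor_le`, Bläser–Lysikov 2016 §2.3), and Bläser's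
Lemma 6.4 (`tensorRank_le_choose_mul_approxRank`, discharged in `SchoenhageTauProofs.lean`) turns an order-`h`
approximate decomposition with `r` triads into an exact one with `C(h+2, 2)·r` triads. Since the order is
POLYNOMIAL in `n` — `C(h+2,2) ≤ n⁴` for `n ≥ 2` (`choose_reesOrder_le_pow_four`) — the RANK of the nil-Coxeter
tensor is within a factor `n⁴ = (n!)^{o(1)}` of the rank of the group-algebra tensor
(`tensorRank_nilCoxeterTensor_le`, `tensorRank_nilCoxeterTensor_le_pow_four_mul`). Consequence for route
`MatrixMultiplication/NilCoxeterShadow` (observed by the crux strategist of stmt-MatrixMultiplication-0956,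
workfile `Cruxes/AThesis/Lines/rank_gap.lean`, whose proof is adapted here): a super-linear lower bound for the
RANK of `T_{NC_n}` (not only for its border rank) already contradicts `ω(K) = 2`.

## References

* M. Bläser, *Fast Matrix Multiplication*, Theory of Computing Graduate Surveys 5 (2013), Lemma 6.4. [Blaser2013]
* M. Bläser, V. Lysikov, *On degeneration of tensors and algebras*, MFCS 2016, arXiv:1606.04253, §2.3,
  Lemma 4. [BlaserLysikov2016]
-/

noncomputable section

namespace Literature.Computability.AlgebraicComplexity

universe u

variable (K : Type u) [CommSemiring K]

/-- **Rank-level degeneration transfer** `R(T_{NC_n}) ≤ C(n(n−1)/2 + 2, 2) · R(T_{K[S_n]})`: compose the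
order-`h` approximate decomposition of `T_{NC_n}` obtained from the Rees twist (`h = n(n−1)/2`,
`approxRank_nilCoxeterTensor_le`) with Bläser's Lemma 6.4 (`tensorRank_le_choose_mul_approxRank`).
[cite: Blaser2013, Lemma 6.4] [cite: BlaserLysikov2016, §2.3, Lemma 4] -/
theorem tensorRank_nilCoxeterTensor_le (n : ℕ) :
    tensorRank (nilCoxeterTensor K n) ≤
      (n * (n - 1) / 2 + 2).choose 2 * tensorRank (groupTensor K (Equiv.Perm (Fin n))) :=
  (tensorRank_le_choose_mul_approxRank (n * (n - 1) / 2) (nilCoxeterTensor K n)).trans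
    (Nat.mul_le_mul_left _ (approxRank_nilCoxeterTensor_le K n))

/-- The conversion factor is polynomial: `C(n(n−1)/2 + 2, 2) ≤ n⁴` for `n ≥ 2` (crude: `C(m,2) ≤ m²` and
`n(n−1)/2 + 2 ≤ n²`). [folklore] -/
theorem choose_reesOrder_le_pow_four {n : ℕ} (hn : 2 ≤ n) : (n * (n - 1) / 2 + 2).choose 2 ≤ n ^ 4 := by
  set m := n * (n - 1) / 2 + 2 with hm
  have h1 : m.choose 2 ≤ m * m := by
    rw [Nat.choose_two_right]
    exact (Nat.div_le_self _ _).trans (Nat.mul_le_mul_left _ (Nat.sub_le _ _))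
  have h2 : m ≤ n * n := by
    have h3 : n * (n - 1) / 2 ≤ n * (n - 1) := Nat.div_le_self _ _
    have h4 : n * (n - 1) + 2 ≤ n * n := by
      obtain ⟨k, rfl⟩ := Nat.exists_eq_add_of_le hn
      rw [show 2 + k - 1 = k + 1 by omega]
      nlinarith
    omega
  calc m.choose 2 ≤ m * m := h1
    _ ≤ (n * n) * (n * n) := Nat.mul_le_mul h2 h2
    _ = n ^ 4 := by ring

/-- **`R(T_{NC_n}) ≤ n⁴ · R(T_{K[S_n]})`** for `n ≥ 2`: the rank of the nil-Coxeter tensor is within the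
polynomial factor `n⁴ = (n!)^{o(1)}` of the rank of the group-algebra tensor of `S_n`.
[cite: Blaser2013, Lemma 6.4] -/
theorem tensorRank_nilCoxeterTensor_le_pow_four_mul {n : ℕ} (hn : 2 ≤ n) :
    tensorRank (nilCoxeterTensor K n) ≤ n ^ 4 * tensorRank (groupTensor K (Equiv.Perm (Fin n))) :=
  (tensorRank_nilCoxeterTensor_le K n).trans (Nat.mul_le_mul_right _ (choose_reesOrder_le_pow_four hn))

end Literature.Computability.AlgebraicComplexity

end
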